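import Mathlib.GroupTheory.SpecificGroups.Alternating
import Summits.MatrixMultiplication.OmegaCensus.BoxUsefulSymmetric

/-!
# ω-census, family (b3): conjecture C9 on the alternating groups — `A_n = alternatingGroup (Fin n)` is box-useful iff `n ≤ 3`

HONEST FRAMING (pub-omega census; verbatim): lottery ticket; floor = certified bounds/negative ranges.
Census BOOKKEEPING (conjecture C9 of the cell; pub-omega stpp-1 gen 18): the embedding `A4h ↪ S₄ ↪ S_n`
(`BoxUsefulSymmetric`) lands in the alternating group — every `A4h.toPerm x` is even (`decide`) and `viaEmbeddingHom`
preserves the sign (`Equiv.Perm.sign_extendDomain`) —, so `A4h ↪ alternatingGroup (Fin n)` for `n ≥ 4` and, by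
`not_boxUseful_of_injective_a4h`, **`A_n` is NOT box-useful for every `n ≥ 4`**; `A_0, A_1, A_2` (trivial) and `A_3 ≅ C₃`
(abelian) ARE.  CLASSIFICATION `boxUseful_alternatingGroup_fin_iff : BoxUseful ↥(alternatingGroup (Fin n)) ↔ n ≤ 3` —
conjecture C9 (b) holds on the whole alternating family (with `A₅`, the smallest non-abelian simple group, on the useless side,
as every non-abelian simple group must be if C9 (b) is true); also `not_boxUseful_perm_of_card_ge`: `Equiv.Perm α` is
not box-useful for every finite type `α` with `|α| ≥ 4`.  Nothing here is progress on `ω`.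
-/

namespace Summit.MatrixMultiplication.OmegaCensus

open Finset ProductBoxBound Equiv

/-- Every element of the image of `A4h` in `S₄` is even. [folklore] -/
theorem A4h.sign_toPerm : ∀ x : A4h, Perm.sign (A4h.toPerm x) = 1 := by decide

/-- `viaEmbeddingHom` preserves the sign. [folklore] -/
theorem sign_viaEmbeddingHom {α β : Type*} [Fintype α] [DecidableEq α] [Fintype β] [DecidableEq β] (ι : α ↪ β)
    (e : Perm α) : Perm.sign (Perm.viaEmbeddingHom ι e) = Perm.sign e := by
  classical
  rw [Perm.viaEmbeddingHom_apply]
  unfold Perm.viaEmbedding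
  convert Perm.sign_extendDomain e (Equiv.ofInjective ι.1 ι.2)

/-- **`A₄` (as `A4h`) embeds into `alternatingGroup (Fin n)` for `n ≥ 4`.** [folklore] -/
noncomputable def A4h.toAlternating {n : ℕ} (h : 4 ≤ n) : A4h →* alternatingGroup (Fin n) :=
  ((Perm.viaEmbeddingHom (Fin.castLEEmb h)).comp A4h.toPermHom).codRestrict _ fun x => by
    rw [Perm.mem_alternatingGroup, MonoidHom.comp_apply, sign_viaEmbeddingHom]
    exact A4h.sign_toPerm x

/-- The embedding is injective. [folklore] -/
theorem A4h.toAlternating_injective {n : ℕ} (h : 4 ≤ n) : Function.Injective (A4h.toAlternating h) := by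
  intro x y e
  have := congrArg Subtype.val e
  exact ((Perm.viaEmbeddingHom_injective _).comp A4h.toPerm_injective) this

/-- **`A_n = alternatingGroup (Fin n)` is not box-useful for every `n ≥ 4`.** [folklore] -/
theorem not_boxUseful_alternatingGroup_fin {n : ℕ} (h : 4 ≤ n) : ¬ BoxUseful (alternatingGroup (Fin n)) :=
  not_boxUseful_of_injective_a4h (A4h.toAlternating h) (A4h.toAlternating_injective h)


/-- **`Equiv.Perm α` is not box-useful for every finite type with at least `4` elements** (`S₄ ↪ S_{|α|} ≅ Perm α`). [folklore] -/
theorem not_boxUseful_perm_of_card_ge {α : Type*} [Fintype α] [DecidableEq α] (h : 4 ≤ Fintype.card α) :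
    ¬ BoxUseful (Perm α) :=
  not_boxUseful_of_injective_a4h
    ((Fintype.equivFin α).permCongrHom.symm.toMonoidHom.comp
      ((Perm.viaEmbeddingHom (Fin.castLEEmb h)).comp A4h.toPermHom))
    ((Fintype.equivFin α).permCongrHom.symm.injective.comp
      ((Perm.viaEmbeddingHom_injective _).comp A4h.toPerm_injective))

/-- `A_0` is box-useful (trivial). [folklore] -/
theorem boxUseful_alternatingGroup_fin_zero : BoxUseful (alternatingGroup (Fin 0)) :=
  BoxUseful.of_index_center_one (center_index_eq_one_of_comm (by decide))

/-- `A_1` is box-useful (trivial). [folklore] -/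
theorem boxUseful_alternatingGroup_fin_one : BoxUseful (alternatingGroup (Fin 1)) :=
  BoxUseful.of_index_center_one (center_index_eq_one_of_comm (by decide))

/-- `A_2` is box-useful (trivial). [folklore] -/
theorem boxUseful_alternatingGroup_fin_two : BoxUseful (alternatingGroup (Fin 2)) :=
  BoxUseful.of_index_center_one (center_index_eq_one_of_comm (by decide))

/-- `A_3 ≅ C₃` is box-useful (abelian). [folklore] -/
theorem boxUseful_alternatingGroup_fin_three : BoxUseful (alternatingGroup (Fin 3)) :=
  BoxUseful.of_index_center_one (center_index_eq_one_of_comm (by decide))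

/-- **CLASSIFICATION of the alternating groups under C9: `alternatingGroup (Fin n)` is box-useful iff `n ≤ 3`.** [folklore] -/
theorem boxUseful_alternatingGroup_fin_iff {n : ℕ} : BoxUseful (alternatingGroup (Fin n)) ↔ n ≤ 3 := by
  constructor
  · intro h
    by_contra hn
    exact not_boxUseful_alternatingGroup_fin (by omega) h
  · intro hn
    interval_cases n
    · exact boxUseful_alternatingGroup_fin_zero
    · exact boxUseful_alternatingGroup_fin_one
    · exact boxUseful_alternatingGroup_fin_two
    · exact boxUseful_alternatingGroup_fin_three

end Summit.MatrixMultiplication.OmegaCensus
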